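import Summits.Schanuel.Schanuel.Theorems.RootDecomp1KLocalExponent05

/-!
# RootDecomp1KLocalExponent — lens 1, generation 54, NODE 14 «THE LOCAL EXPONENT: the named targets contactC at m₀ = 2 and highContactC at m₀ = 2, 3, 4 decided hypothesis-free» (RULE K-R42 (vii′) named-target clause, K-R44, K-R45) — continuation (RootDecomp1KLocalExponent06): §10 highContactC at m₀ = 2 (critical segment empty), §11 bookkeeping

(lens-1 g54 NODE 14 HOME kernel K = HOME/decomp-schanuel-lens-1/g54/LocalExponent.lean 0a24ac98…, 1537 l, 93 thm + 7 def, imports tree …RootDecomp1KHeightMachine05 ONLY (no Literature import); Probe / Ctrl0 / Ctrl + NODE-g54.md + SHA256SUMS; CLAIM L2617, crit EX-ANTE PRICE L2618 (ONE THEOREM ×1 under RULE K-R42 (vii′), NAMED-TARGET clause of L2599, iff CHECKLIST K-g54; RULE K-R45 pre-announced: local toolkit closure + frontier certificate, census instrument LIVENESS-v4), NODE L2621 / REQUEST L2622, census STAGING NOTE 4 L2623, critic VERDICT L2624: CLEARED — THEOREM ×1 under RULE K-R42 (vii′) (named-target clause), CHECKLIST K-g54 met; RULE K-R45 FIXED (local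 suppliers of record; LIVENESS-v4 = frontier certificate; unconditional part DecidedAt ∨ MachineDecidedAt ∨ LocalAt); PORT GO (verbatim; docstrings / the sanctioned privatisation only). Port by census-1 gen 22 as `RootDecomp1KLocalExponent01–06` (`--supports stmt-Schanuel-33364`; no census credit): 01 = §1 helpers + §2 the three local inputs (closed range of ℚ₂ in ℂ₂ `exists_pos_le_norm_ratCast_sub`; the 2-adic LIOUVILLE inequality at a RATIONAL centre `liouville_rat`; the nearest root with its OWN multiplicity); 02 = §3 the bounded region near a root + §4 the point (∞,∞) by its NEWTON SLOPES (`dTop`, `far_slope`, `slope_arith`, `FarClause`, `SlopeCond`, `farClause_of_slopeCond`, `farClause_of_empty`); 03 = §5 THE THEOREM **`thinFibreAt_of_localAt : LocalAt m₀ P → ThinFibreAt m₀ P`** (every m₀; `rootMult`, `RootCond`, `LocalAt`, engine `thinFibreAt_of_rootCond_farClause`, spelled-out `thinFibreAt_local`) + §5b presentation independence `localAt_iff`; 04 = §6 positioning (`localAt_of_thinThreshold_le`, `localAt_of_rootlessTop(_le)`, the tree theorems re-derived) + §7 the top Y⁵ − 1 (`padic_pow_five_eq_one`, `rootCond_two_pow_five_sub_one`)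 + §8 the NAMED TARGETS **`thinFibreAt_contact_two : ThinFibreAt 2 (xPolyP 2 contactC)`**, `thinFibreAt_highContact_three` / `_four` / `_highContact'`; 05 = §9 costume tests of the members + two refused tops; 06 = §10 **`thinFibreAt_highContact_two`** (outside the class: the critical segment v₂(r) = −N!/2 is EMPTY) + §11 bookkeeping ×0 (`LocalOffAt`, residual re-graded). PORT EDITS: the two generic one-liners `norm_natCast_le_one_Cp` / `norm_intCast_le_one_Cp` PRIVATISED (head dry-run dedup.foreign notes vs Summit.ABC… / Summit.BirchSwinnertonDyer… twins; file-local copies re-emitted where used); otherwise none on declarations (K fully documented; no set_option / cite-token); provenance doc blocks + continuation headers = K's own open-lines only; statements and proofs VERBATIM. Rung 0 — nothing here proves Schanuel, 33364, 33363, 31077 or ThinFibre 2; the class `LocalAt` and the named targets are HYPOTHESIS-FREE, §11 is conditional on PadicSubspace / HeightComparison.)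
-/

noncomputable section

namespace Summit.Schanuel.Schanuel.Theorems.RootDecomp1KLocalExponent

open Polynomial LiouvilleNumber
open scoped Nat
open Summit.Schanuel.Schanuel.Theorems.RootDecomp1KTwoBaseCell (psNumer partialSum_eq_psNumer_div coprime_psNumer)
open Summit.Schanuel.Schanuel.Theorems.RootDecomp1KRelLiouvilleCell (partialSum_two_strictMono)
open Summit.Schanuel.Schanuel.Theorems.RootDecomp1KDegreeLadder
open Summit.Schanuel.Schanuel.Theorems.RootDecomp1KXLinearCore
open Summit.Schanuel.Schanuel.Theorems.RootDecomp1KXLinear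
open Summit.Schanuel.Schanuel.Theorems.RootDecomp1KXLinearII
open Summit.Schanuel.Schanuel.Theorems.RootDecomp1KXTop
open Summit.Schanuel.Schanuel.Theorems.RootDecomp1KXAll
open Summit.Schanuel.Schanuel.Theorems.RootDecomp1KLevelFinite
open Summit.Schanuel.Schanuel.Theorems.RootDecomp1KSubspaceBranch
open Summit.Schanuel.Schanuel.Theorems.RootDecomp1KHeightMachine

/-! ## §10  `highContactC` at `m₀ = 2`: the CRITICAL SEGMENT `v₂(r) = −N!/2` IS EMPTY — decided OUTSIDE the class -/

/-- a unit of `ℚ₂` reduces to `1 ∈ 𝔽₂`: `‖y − 1‖₂ ≤ 1/2`. -/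
theorem padic_unit_sub_one_le {y : ℚ_[2]} (hy : ‖y‖ = 1) : ‖y - 1‖ ≤ 1 / 2 := by
  set x : ℤ_[2] := ⟨y, hy.le⟩ with hx
  have hxy : ((x : ℤ_[2]) : ℚ_[2]) = y := rfl
  obtain ⟨n, hn2, hmem⟩ := PadicInt.exists_mem_range x
  rw [PadicInt.maximalIdeal_eq_span_p, Ideal.mem_span_singleton'] at hmem
  obtain ⟨t, ht⟩ := hmem
  have hle : ‖((x - n : ℤ_[2]) : ℚ_[2])‖ ≤ 1 / 2 := by
    rw [← ht, PadicInt.coe_mul, norm_mul, PadicInt.coe_natCast, Padic.norm_p]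
    have h1 : ‖(t : ℚ_[2])‖ ≤ 1 := t.2
    have h2 : ((2 : ℕ) : ℝ)⁻¹ = 1 / 2 := by norm_num
    rw [h2]
    exact (mul_le_mul_of_nonneg_right h1 (by norm_num)).trans_eq (one_mul _)
  rw [PadicInt.coe_sub, PadicInt.coe_natCast, hxy] at hle
  interval_cases n
  · rw [Nat.cast_zero, sub_zero] at hle; linarith
  · rw [Nat.cast_one] at hle; exact hle

/-- for a RATIONAL `2`-adic unit `s`: `‖s² − 1‖₂ ≤ 1/4` in `ℂ₂` (`s ≡ ±1 mod 2`, so `s − 1`, `s + 1` are even). -/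
theorem norm_sq_sub_one_le {s : ℚ} (hs : ‖(s : PadicAlgCl 2)‖ = 1) : ‖(s : PadicAlgCl 2) ^ 2 - 1‖ ≤ 1 / 4 := by
  have hiso : ∀ y : ℚ_[2], ‖algebraMap ℚ_[2] (PadicAlgCl 2) y‖ = ‖y‖ := fun y => PadicAlgCl.norm_extends (p := 2) y
  have hs' : ‖(s : ℚ_[2])‖ = 1 := by rw [← hiso, ← ratCast_mem_range]; exact hs
  have h1 : ‖(s : PadicAlgCl 2) - 1‖ ≤ 1 / 2 := by
    have := padic_unit_sub_one_le hs'
    rw [← hiso, map_sub, map_one, ← ratCast_mem_range] at this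
    exact this
  have h2 : ‖(s : PadicAlgCl 2) + 1‖ ≤ 1 / 2 := by
    have e : (s : PadicAlgCl 2) + 1 = ((s : PadicAlgCl 2) - 1) + 2 := by ring
    rw [e]
    exact (IsUltrametricDist.norm_add_le_max _ _).trans (max_le h1 (le_of_eq norm_two_Cp))
  have e : (s : PadicAlgCl 2) ^ 2 - 1 = ((s : PadicAlgCl 2) - 1) * ((s : PadicAlgCl 2) + 1) := by ring
  rw [e, norm_mul]
  calc ‖(s : PadicAlgCl 2) - 1‖ * ‖(s : PadicAlgCl 2) + 1‖ ≤ (1 / 2) * (1 / 2) :=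
        mul_le_mul h1 h2 (norm_nonneg _) (by norm_num)
    _ = 1 / 4 := by norm_num

/-- **the far region of `highContactC` is EMPTY**: for `N ≥ 3` NO level point has `‖r‖₂ > 1`.  Newton polygon of
`p_N²(r⁵ − 1) = −(2^{2N!}(r⁹ − 1) + p_N·2^{N!}·r)`: a point with `u = ‖r‖₂ > 1` must lie on the critical segment
`u = 2^{N!/2}`; there `s = 2^{h}·r` (`h = N!/2`) is a rational `2`-adic unit and
`s⁵(p_N² + s⁴) = p_N²·2^{5h} + 2^{9h} − p_N·s·2^{6h}` is impossible: `‖p_N² + s⁴‖₂ = 1/2` (`p_N², s⁴ ≡ 1 mod 4`)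
while the right side has norm `≤ 2^{−5h}`. -/
theorem highContact_far_empty {N : ℕ} (hN : 3 ≤ N) (r : ℚ)
    (hP : bev (xPolyP 2 highContactC) (partialSum 2 N) r = 0) : ‖(r : PadicAlgCl 2)‖ ≤ 1 := by
  by_contra hu
  push Not at hu
  obtain ⟨h, hh⟩ : 2 ∣ N ! := Nat.dvd_factorial (by norm_num) (by omega)
  have hh1 : 1 ≤ h := by have := Nat.factorial_pos N; omega
  -- the level identity, made explicit
  have a0 : aeval (r : PadicAlgCl 2) (highContactC 0) = (r : PadicAlgCl 2) ^ 9 - 1 := by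
    show aeval (r : PadicAlgCl 2) (X ^ 9 - 1 : ℤ[X]) = _; simp
  have a1 : aeval (r : PadicAlgCl 2) (highContactC 1) = (r : PadicAlgCl 2) := by
    show aeval (r : PadicAlgCl 2) (X : ℤ[X]) = _; exact aeval_X _
  have a2 : aeval (r : PadicAlgCl 2) (highContactC 2) = (r : PadicAlgCl 2) ^ 5 - 1 := by
    show aeval (r : PadicAlgCl 2) (X ^ 5 - 1 : ℤ[X]) = _; simp
  have hE := level_identity 2 highContactC N r hP
  simp only [Finset.sum_range_succ, Finset.sum_range_zero, zero_add, pow_zero, one_mul, pow_one,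
    Nat.sub_zero, Nat.reduceSub, a0, a1, a2] at hE
  rw [hh] at hE
  set p : PadicAlgCl 2 := (psNumer 2 N : PadicAlgCl 2) with hpdef
  set u : ℝ := ‖(r : PadicAlgCl 2)‖ with hudef
  have hu0 : 0 < u := lt_trans one_pos hu
  set T : PadicAlgCl 2 := (2 : PadicAlgCl 2) ^ h with hTdef
  have hp1 : ‖p‖ = 1 := norm_psNumer hN
  have hT : ‖T‖ = (1 / 2 : ℝ) ^ h := norm_two_pow_Cp h
  have hT1 : ‖T‖ ≤ 1 / 2 := by rw [hT]; exact pow_le_of_le_one (by norm_num) (by norm_num) (by omega)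
  have hE' : p ^ 2 * ((r : PadicAlgCl 2) ^ 5 - 1) =
      -(T ^ 4 * ((r : PadicAlgCl 2) ^ 9 - 1) + p * T ^ 2 * (r : PadicAlgCl 2)) := by
    rw [hTdef]; linear_combination hE
  -- norms of the three terms
  have hr5 : ‖(r : PadicAlgCl 2) ^ 5 - 1‖ = u ^ 5 := by
    have h5 : 1 < u ^ 5 := one_lt_pow₀ hu (by norm_num)
    have hne : ‖(r : PadicAlgCl 2) ^ 5‖ ≠ ‖(-1 : PadicAlgCl 2)‖ := by
      rw [norm_pow, norm_neg, norm_one]; exact ne_of_gt h5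
    rw [sub_eq_add_neg, IsUltrametricDist.norm_add_eq_max_of_norm_ne_norm hne, norm_pow, norm_neg, norm_one,
      max_eq_left h5.le]
  have hr9 : ‖(r : PadicAlgCl 2) ^ 9 - 1‖ = u ^ 9 := by
    have h9 : 1 < u ^ 9 := one_lt_pow₀ hu (by norm_num)
    have hne : ‖(r : PadicAlgCl 2) ^ 9‖ ≠ ‖(-1 : PadicAlgCl 2)‖ := by
      rw [norm_pow, norm_neg, norm_one]; exact ne_of_gt h9
    rw [sub_eq_add_neg, IsUltrametricDist.norm_add_eq_max_of_norm_ne_norm hne, norm_pow, norm_neg, norm_one,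
      max_eq_left h9.le]
  have hL : ‖p ^ 2 * ((r : PadicAlgCl 2) ^ 5 - 1)‖ = u ^ 5 := by
    rw [norm_mul, norm_pow, hp1, one_pow, one_mul, hr5]
  have hA : ‖T ^ 4 * ((r : PadicAlgCl 2) ^ 9 - 1)‖ = ‖T‖ ^ 4 * u ^ 9 := by rw [norm_mul, norm_pow, hr9]
  have hB : ‖p * T ^ 2 * (r : PadicAlgCl 2)‖ = ‖T‖ ^ 2 * u := by
    rw [norm_mul, norm_mul, norm_pow, hp1, one_mul]
  have hsum : ‖T ^ 4 * ((r : PadicAlgCl 2) ^ 9 - 1) + p * T ^ 2 * (r : PadicAlgCl 2)‖ = u ^ 5 := by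
    rw [← norm_neg, ← hE', hL]
  -- the segment of slope `> 1/2` carries nothing: `‖B‖ < ‖A‖`
  have hBA : ‖T‖ ^ 2 * u < ‖T‖ ^ 4 * u ^ 9 := by
    by_contra hle
    push Not at hle
    have h1 : u ^ 5 ≤ ‖T‖ ^ 2 * u := by
      rw [← hsum]
      refine (IsUltrametricDist.norm_add_le_max _ _).trans ?_
      rw [hA, hB]; exact max_le hle le_rfl
    have h2 : ‖T‖ ^ 2 * u ≤ (1 / 2 : ℝ) ^ 2 * u :=
      mul_le_mul_of_nonneg_right (pow_le_pow_left₀ (norm_nonneg _) hT1 2) hu0.le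
    have h3 : u < u ^ 5 := lt_self_pow₀ hu (by norm_num)
    nlinarith
  have hne : ‖T ^ 4 * ((r : PadicAlgCl 2) ^ 9 - 1)‖ ≠ ‖p * T ^ 2 * (r : PadicAlgCl 2)‖ := by
    rw [hA, hB]; exact ne_of_gt hBA
  -- so the point lies on the CRITICAL segment: `u⁵ = ‖T‖⁴u⁹`, i.e. `‖T‖·u = 1`
  have hmax : u ^ 5 = ‖T‖ ^ 4 * u ^ 9 := by
    rw [← hsum, IsUltrametricDist.norm_add_eq_max_of_norm_ne_norm hne, hA, hB, max_eq_left hBA.le]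
  have hTu : ‖T‖ * u = 1 := by
    have h1 : (‖T‖ * u) ^ 4 = 1 ^ 4 := by
      rw [mul_pow, one_pow]
      have h' : u ^ 5 * (‖T‖ ^ 4 * u ^ 4) = u ^ 5 * 1 := by
        rw [mul_one]
        calc u ^ 5 * (‖T‖ ^ 4 * u ^ 4) = ‖T‖ ^ 4 * u ^ 9 := by ring
          _ = u ^ 5 := hmax.symm
      exact mul_left_cancel₀ (pow_pos hu0 5).ne' h'
    exact (pow_left_inj₀ (by positivity) zero_le_one (by norm_num)).mp h1
  -- the rational `2`-adic unit `s = 2^h · r`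
  set s : ℚ := 2 ^ h * r with hsdef
  have hsC : (s : PadicAlgCl 2) = T * (r : PadicAlgCl 2) := by rw [hsdef, hTdef]; push_cast; ring
  have hs1 : ‖(s : PadicAlgCl 2)‖ = 1 := by rw [hsC, norm_mul, hTu]
  -- the identity × T⁵:  `s⁵ (p² + s⁴) = p² T⁵ + T⁹ − p T⁶ s`
  have hI : (s : PadicAlgCl 2) ^ 5 * (p ^ 2 + (s : PadicAlgCl 2) ^ 4) =
      p ^ 2 * T ^ 5 + T ^ 9 - p * T ^ 6 * (s : PadicAlgCl 2) := by
    rw [hsC]; linear_combination T ^ 5 * hE'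
  -- the right side is small …
  have hRHS : ‖p ^ 2 * T ^ 5 + T ^ 9 - p * T ^ 6 * (s : PadicAlgCl 2)‖ ≤ (1 / 2 : ℝ) ^ 5 := by
    have hT5 : ‖T‖ ^ 5 ≤ (1 / 2 : ℝ) ^ 5 := pow_le_pow_left₀ (norm_nonneg _) hT1 5
    have hTle1 : ‖T‖ ≤ 1 := hT1.trans (by norm_num)
    have h1 : ‖p ^ 2 * T ^ 5‖ ≤ (1 / 2 : ℝ) ^ 5 := by
      rw [norm_mul, norm_pow, hp1, one_pow, one_mul, norm_pow]; exact hT5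
    have h2 : ‖T ^ 9‖ ≤ (1 / 2 : ℝ) ^ 5 := by
      rw [norm_pow]
      exact (pow_le_pow_of_le_one (norm_nonneg _) hTle1 (by norm_num : 5 ≤ 9)).trans hT5
    have h3 : ‖p * T ^ 6 * (s : PadicAlgCl 2)‖ ≤ (1 / 2 : ℝ) ^ 5 := by
      rw [norm_mul, norm_mul, norm_pow, hp1, one_mul, hs1, mul_one]
      exact (pow_le_pow_of_le_one (norm_nonneg _) hTle1 (by norm_num : 5 ≤ 6)).trans hT5
    rw [sub_eq_add_neg]
    refine (IsUltrametricDist.norm_add_le_max _ _).trans (max_le ?_ ?_)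
    · exact (IsUltrametricDist.norm_add_le_max _ _).trans (max_le h1 h2)
    · rw [norm_neg]; exact h3
  -- … but the left side has norm EXACTLY `1/2`
  have hp2 : ‖p ^ 2 - 1‖ ≤ 1 / 4 := by
    have hE1 : 1 ≤ Nat.factorial N - Nat.factorial (N - 1) := by
      have := (Nat.factorial_lt (show 0 < N - 1 by omega)).mpr (show N - 1 < N by omega)
      omega
    have hpm : ‖p - 1‖ ≤ 1 / 2 := by
      refine (norm_psNumer_sub_one (show 1 ≤ N by omega)).trans ?_
      exact (pow_le_pow_of_le_one (by norm_num) (by norm_num) hE1).trans_eq (pow_one _)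
    have hpp : ‖p + 1‖ ≤ 1 / 2 := by
      have e : p + 1 = (p - 1) + 2 := by ring
      rw [e]; exact (IsUltrametricDist.norm_add_le_max _ _).trans (max_le hpm (le_of_eq norm_two_Cp))
    have e : p ^ 2 - 1 = (p - 1) * (p + 1) := by ring
    rw [e, norm_mul]
    calc ‖p - 1‖ * ‖p + 1‖ ≤ (1 / 2) * (1 / 2) := mul_le_mul hpm hpp (norm_nonneg _) (by norm_num)
      _ = 1 / 4 := by norm_num
  have hs4 : ‖(s : PadicAlgCl 2) ^ 4 - 1‖ ≤ 1 / 4 := by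
    have e : (s : PadicAlgCl 2) ^ 4 - 1 = ((s : PadicAlgCl 2) ^ 2 - 1) * ((s : PadicAlgCl 2) ^ 2 + 1) := by ring
    rw [e, norm_mul]
    have h1 := norm_sq_sub_one_le hs1
    have h2 : ‖(s : PadicAlgCl 2) ^ 2 + 1‖ ≤ 1 := by
      refine (IsUltrametricDist.norm_add_le_max _ _).trans (max_le ?_ (le_of_eq norm_one))
      rw [norm_pow, hs1, one_pow]
    calc ‖(s : PadicAlgCl 2) ^ 2 - 1‖ * ‖(s : PadicAlgCl 2) ^ 2 + 1‖ ≤ (1 / 4) * 1 :=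
          mul_le_mul h1 h2 (norm_nonneg _) (by norm_num)
      _ = 1 / 4 := by norm_num
  have hLHS : ‖(s : PadicAlgCl 2) ^ 5 * (p ^ 2 + (s : PadicAlgCl 2) ^ 4)‖ = 1 / 2 := by
    rw [norm_mul, norm_pow, hs1, one_pow, one_mul]
    have e : p ^ 2 + (s : PadicAlgCl 2) ^ 4 = 2 + ((p ^ 2 - 1) + ((s : PadicAlgCl 2) ^ 4 - 1)) := by ring
    have hD : ‖(p ^ 2 - 1) + ((s : PadicAlgCl 2) ^ 4 - 1)‖ ≤ 1 / 4 :=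
      (IsUltrametricDist.norm_add_le_max _ _).trans (max_le hp2 hs4)
    have hne2 : ‖(2 : PadicAlgCl 2)‖ ≠ ‖(p ^ 2 - 1) + ((s : PadicAlgCl 2) ^ 4 - 1)‖ := by
      rw [norm_two_Cp]; exact ne_of_gt (lt_of_le_of_lt hD (by norm_num))
    rw [e, IsUltrametricDist.norm_add_eq_max_of_norm_ne_norm hne2, norm_two_Cp,
      max_eq_left (hD.trans (by norm_num))]
  have hfin : ‖(s : PadicAlgCl 2) ^ 5 * (p ^ 2 + (s : PadicAlgCl 2) ^ 4)‖ ≤ (1 / 2 : ℝ) ^ 5 := by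
    rw [hI]; exact hRHS
  rw [hLHS] at hfin
  norm_num at hfin

/-- **NAMED TARGET 4 (L2599 (vii′), the risk item): `ThinFibreAt 2 (xPolyP 2 highContactC)` — HYPOTHESIS-FREE**,
decided OUTSIDE node 14's class (`¬ LocalAt 2`, (c-δ)) by the engine with the far clause supplied by EMPTINESS of
the critical segment (`farClause_of_empty` + `highContact_far_empty`) and the root condition of `Y⁵ − 1` at `2`. -/
theorem thinFibreAt_highContact_two : ThinFibreAt 2 (xPolyP 2 highContactC) :=
  thinFibreAt_of_rootCond_farClause 2 highContactC pow_five_sub_one_ne_zero rootCond_two_pow_five_sub_one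
    (farClause_of_empty 1 3 (fun _ hN r hP => highContact_far_empty hN r hP) 2)

/-- `highContactC` at EVERY `m₀ ≥ 2`, hypothesis-free (tree: `5 ≤ m₀`). -/
theorem thinFibreAt_highContact_all {m₀ : ℕ} (hm : 2 ≤ m₀) : ThinFibreAt m₀ (xPolyP 2 highContactC) :=
  thinFibreAt_mono hm thinFibreAt_highContact_two

/-! ## §11  BOOKKEEPING (×0): the residual of record re-graded by the local class -/

/-- [residual statement def — NOT proved; census convention] Siegel's clause OFF everything decided at `m₀`, OFF
the height-machine class AND OFF the local class `LocalAt m₀`. -/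
def LocalOffAt (m₀ : ℕ) : Prop :=
  ∀ P : ℤ[X][X], Prime P → 2 ≤ P.natDegree → ¬ DecidedAt m₀ P → ¬ MachineDecidedAt m₀ P → ¬ LocalAt m₀ P →
    SiegelClause P

/-- the weakening, PROVED: `MachineOffAt m₀ → LocalOffAt m₀`. -/
theorem localOffAt_of_machineOffAt {m₀ : ℕ} (h : MachineOffAt m₀) : LocalOffAt m₀ :=
  fun P hP hd hnd hnm _ => h P hP hd hnd hnm

/-- **the residual re-graded, NO binder**: `ThinFibre m₀ ⟸ LocalOffAt m₀` (`m₀ ≥ 2`) — after node 14 the UNCONDITIONAL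
part of the K-line at quality `m₀` is `DecidedAt m₀ ∨ MachineDecidedAt m₀ ∨ LocalAt m₀`.  Bookkeeping ×0. -/
theorem thinFibre_of_localOffAt {m₀ : ℕ} (hm : 2 ≤ m₀) (hR : LocalOffAt m₀) : ThinFibre m₀ := by
  refine thinFibre_of_prime hm fun P hP hd => ?_
  by_cases h : DecidedAt m₀ P
  · exact thinFibreAt_of_decidedAt hm hP.ne_zero h
  by_cases h' : MachineDecidedAt m₀ P
  · exact thinFibreAt_of_machineDecidedAt h'
  by_cases h'' : LocalAt m₀ P
  · exact thinFibreAt_of_localAt h''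
  exact thinFibreAt_of_levelFinite (levelFinite_of_siegelClause (hR P hP hd h h' h'')) m₀

end Summit.Schanuel.Schanuel.Theorems.RootDecomp1KLocalExponent

end
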